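import Summits.CriticalPhenomena.SAWScalingLimit.Theorems.SAWCompassLatticeSurfaceUniversalityDefs
import Literature.Probability.RandomPlanarGeometry.SAWCount

/-!
# Sketch — first lemmas of the two crux ideas filed by ideator k=2 (round 1) on
# `SAWTrackTransport.YBtoUniform` (stmt-CriticalPhenomena-16966)

Statements only (`def … : Prop`), over landed declarations:
`fwLaw / fwMeasure / fwWeight / unifLaw` (Theorems.SurfaceUniversality, the free face-weight family on
GM's square-tiling walk space), `ybLaw`, `YBWalk.*`, `IsYBEndpointApprox`, `SAW.Zd.saws`.

* Idea `score-transport`: `ScoreIdentity` (exact, provable now), `pStraight`, `ExcessStraightLocality`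
  (the kernel at the uniform end), `ScoreLocality` (the kernel along a path), `RestrictionTollSym`.
* Idea `loop-erased-backbone`: `NoMesoscopicOsculation` (LE-1), `AttachedExcursionTail` (the kernel).
-/

noncomputable section

namespace Summit.CriticalPhenomena.SAWScalingLimit.Cruxes.YBtoUniform.IdeatorSketchK2

open MeasureTheory Filter Topology Set
open scoped NNReal ENNReal
open Literature.Probability.RandomPlanarGeometry
open Literature.Probability.RandomPlanarGeometry.SAW
open Literature.Probability.RandomPlanarGeometry.SAW.YangBaxter
open Literature.Probability.LatticeModels (Site)
open Summit.CriticalPhenomena.SAWScalingLimit.Theorems.SurfaceUniversality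

/-! ### Local counts along a Yang–Baxter walk -/

section Counts

variable {D : Set Face} {a z : MidEdge}

/-- Number of arcs `|γ|` (= `N₁ + N_s + 2 N_osc`). -/
def numArcs (γ : YBWalk D a z) : ℕ := γ.arcs.length

/-- Number of faces carrying exactly one STRAIGHT arc. -/
def numStraight (γ : YBWalk D a z) : ℕ :=
  (γ.facesVisited.filter fun f => γ.kindsIn f = [ArcKind.straight]).card

/-- Number of faces visited TWICE (osculations). -/
def numOsc (γ : YBWalk D a z) : ℕ :=
  (γ.facesVisited.filter fun f => (γ.kindsIn f).length = 2).card

/-- The tangent score of the D4-symmetric sub-family `(u, u, ρu, τu², τu²)` along a path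
`t ↦ (u t, ρ t, τ t)`: `S_t(γ) = (u'/u)|γ| + (ρ'/ρ) N_s(γ) + (τ'/τ) N_osc(γ)` (`= ∂_t log W_t(γ)`). -/
def score (u ρ τ : ℝ → ℝ) (t : ℝ) (γ : YBWalk D a z) : ℝ :=
  deriv u t / u t * numArcs γ + deriv ρ t / ρ t * numStraight γ + deriv τ t / τ t * numOsc γ

end Counts

/-- The D4-symmetric face-weight law at `(u, ρ, τ)`: weights `(u₁,u₂,v,w₁,w₂) = (u, u, ρu, τu², τu²)`.
The uniform point is `(x_c, 1, 0)`, GM's integrable point is `(u₁(π/2), v/u₁ ≈ 0.786, w₁/u₁² ≈ 0.676)`. -/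
def symLaw (u ρ τ : ℝ) (Ω : Set ℂ) (δ : ℝ) (a b : MidEdge) :
    Measure (YangBaxterSAW rightAngles Ω δ a b) :=
  fwLaw u u (ρ * u) (τ * u ^ 2) (τ * u ^ 2) Ω δ a b

/-- Its partition function `Z_{(u,ρ,τ)}(Ω_δ; a, b)`. -/
def symZ (u ρ τ : ℝ) (Ω : Set ℂ) (δ : ℝ) (a b : MidEdge) : ℝ≥0∞ :=
  fwMeasure u u (ρ * u) (τ * u ^ 2) (τ * u ^ 2) Ω δ a b Set.univ

/-! ### Idea 1 — `score-transport` -/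

/-- **FIRST LEMMA (exact, provable now): the Fisher-score identity for exact-restriction ratios.**
For nested plane sets `Ω' ⊆ Ω` with finitely many faces at mesh `δ`, common end mid-edges joined in
`Ω'_δ`, and a `C¹` path of POSITIVE symmetric weights, the log of the restriction ratio
`R_t = Z_t(Ω'_δ)/Z_t(Ω_δ) = P_{t,Ω}(γ ⊆ Ω'_δ)` has derivative `⟨S_t⟩_{Ω'} − ⟨S_t⟩_{Ω}`. -/
def ScoreIdentity : Prop :=
  ∀ (u ρ τ : ℝ → ℝ) (t : ℝ) (Ω Ω' : Set ℂ) (δ : ℝ) (a b : MidEdge),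
    Ω' ⊆ Ω → (meshFaces rightAngles Ω δ).Finite → Nonempty (YangBaxterSAW rightAngles Ω' δ a b) →
    DifferentiableAt ℝ u t → DifferentiableAt ℝ ρ t → DifferentiableAt ℝ τ t →
    0 < u t → 0 < ρ t → 0 < τ t →
    HasDerivAt (fun s => Real.log ((symZ (u s) (ρ s) (τ s) Ω' δ a b).toReal /
        (symZ (u s) (ρ s) (τ s) Ω δ a b).toReal))
      ((∫ γ, score u ρ τ t γ ∂(symLaw (u t) (ρ t) (τ t) Ω' δ a b)) -
        ∫ γ, score u ρ τ t γ ∂(symLaw (u t) (ρ t) (τ t) Ω δ a b)) t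

/-- Straight steps of an `n`-step walk `ω` on `ℤ²`: times `1 ≤ i ≤ n-1` with `ω(i+1) − ω(i) = ω(i) − ω(i−1)`. -/
def straightSteps (n : ℕ) (ω : ℕ → Site 2) : ℕ :=
  ((Finset.Icc 1 (n - 1)).filter fun i => ω (i + 1) - ω i = ω i - ω (i - 1)).card

/-- **The bulk straight density `p_s` of the square-lattice SAW** (mean fraction of straight steps of a
uniform `n`-step walk, `n → ∞`; the limit exists by Kesten's pattern theorem — here a `limsup` to avoid
the existence clause). -/
def pStraight : ℝ :=
  Filter.limsup (fun n : ℕ => (∑ ω ∈ SAW.Zd.saws 2 n, (straightSteps n ω : ℝ)) /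
    ((SAW.Zd.saws 2 n).card * n)) atTop

/-- Hull sub-domain hypothesis (as in the strategist's `RestrictionToll`): `D' ⊆ D`, same marked points,
and `D'` agrees with `D` near them. -/
def IsHullSub (D D' : DobrushinDomain) : Prop :=
  D'.carrier ⊆ D.carrier ∧ D'.pt 0 = D.pt 0 ∧ D'.pt 1 = D.pt 1 ∧
    ∃ ε : ℝ, 0 < ε ∧ D'.carrier ∩ Metric.ball (D.pt 0) ε = D.carrier ∩ Metric.ball (D.pt 0) ε ∧
      D'.carrier ∩ Metric.ball (D.pt 1) ε = D.carrier ∩ Metric.ball (D.pt 1) ε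

/-- **KERNEL, first instance (uniform end, bending direction): excess-straight locality of the critical
`ℤ²` SAW.** The mean EXCESS number of straight passages `⟨N_s − p_s |γ|⟩` of the critical square-lattice
SAW (as the uniform face-weight walk `unifLaw`) is asymptotically the same in a Dobrushin domain and in any
hull sub-domain sharing its marked points. (Each mean is `O(δ^{-4/3})` before centring and `O(1)` after;
the claim is the `o(1)` agreement of the centred means.) -/
def ExcessStraightLocality : Prop :=
  ∀ (D D' : DobrushinDomain) (a' b' : ℝ → MidEdge), IsHullSub D D' →
    IsYBEndpointApprox rightAngles D a' b' → IsYBEndpointApprox rightAngles D' a' b' →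
    Tendsto (fun δ : ℝ =>
        (∫ γ, ((numStraight γ : ℝ) - pStraight * numArcs γ) ∂(unifLaw D.carrier δ (a' δ) (b' δ))) -
          ∫ γ, ((numStraight γ : ℝ) - pStraight * numArcs γ) ∂(unifLaw D'.carrier δ (a' δ) (b' δ)))
      (𝓝[>] (0 : ℝ)) (𝓝 0)

/-- **KERNEL (general form): score locality along a critical path.** For a path `t ↦ (u t, ρ t, τ t)`,
`t ∈ [0,1]` (meant: inside the critical surface `u · μ(ρ, τ) = 1`, from the uniform point to GM's point),
the mean tangent score is asymptotically domain-insensitive, uniformly in `t`. -/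
def ScoreLocality (u ρ τ : ℝ → ℝ) : Prop :=
  ∀ (D D' : DobrushinDomain) (a' b' : ℝ → MidEdge), IsHullSub D D' →
    IsYBEndpointApprox rightAngles D a' b' → IsYBEndpointApprox rightAngles D' a' b' →
    TendstoUniformlyOn
      (fun (δ : ℝ) (t : ℝ) =>
        (∫ γ, score u ρ τ t γ ∂(symLaw (u t) (ρ t) (τ t) D.carrier δ (a' δ) (b' δ))) -
          ∫ γ, score u ρ τ t γ ∂(symLaw (u t) (ρ t) (τ t) D'.carrier δ (a' δ) (b' δ)))
      (fun _ => 0) (𝓝[>] (0 : ℝ)) (Set.Icc 0 1)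

/-- **What the two give (restriction toll, symmetric-family form)**: along such a path the hull-avoidance
probabilities of the two end-point models merge — `R_1^δ − R_0^δ → 0` — by integrating `ScoreIdentity`
in `t` (this is the strategist's `RestrictionToll` up to the conventions legs `unifLaw ↔ SAW.law`). -/
def RestrictionTollSym (u ρ τ : ℝ → ℝ) : Prop :=
  ∀ (D D' : DobrushinDomain) (a' b' : ℝ → MidEdge), IsHullSub D D' →
    IsYBEndpointApprox rightAngles D a' b' → IsYBEndpointApprox rightAngles D' a' b' →
    Tendsto (fun δ : ℝ =>
        ((symZ (u 1) (ρ 1) (τ 1) D'.carrier δ (a' δ) (b' δ)).toReal /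
            (symZ (u 1) (ρ 1) (τ 1) D.carrier δ (a' δ) (b' δ)).toReal) -
          (symZ (u 0) (ρ 0) (τ 0) D'.carrier δ (a' δ) (b' δ)).toReal /
            (symZ (u 0) (ρ 0) (τ 0) D.carrier δ (a' δ) (b' δ)).toReal)
      (𝓝[>] (0 : ℝ)) (𝓝 0)

/-- The shape of the line (the composition is calculus: `log R_1 − log R_0 = ∫₀¹ Δ_t dt`). -/
def ScoreTransportShape (u ρ τ : ℝ → ℝ) : Prop :=
  ScoreIdentity → ScoreLocality u ρ τ → RestrictionTollSym u ρ τ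

/-- **KERNEL, sharp one-point form (K1): one-point decay of the centred straight score of the
critical `ℤ²` SAW.** Conditionally on visiting a face `F`, the probability that the uniform critical
face-walk passes STRAIGHT through `F` differs from the bulk density `p_s` by at most
`C · (δ / dist(δF, ∂D))^y` for some `y > 4/3 = 1/ν` (CFT: `y = 2`; any `y > 4/3` makes the centred sums
`o(1)` away from the marked points). One model, one-point functions, no test functional. -/
def OnePointStraightDecay : Prop :=
  ∃ y C : ℝ, 4 / 3 < y ∧ 0 < C ∧
    ∀ (D : DobrushinDomain) (a' b' : ℝ → MidEdge), IsYBEndpointApprox rightAngles D a' b' →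
      ∀ᶠ δ in 𝓝[>] (0 : ℝ), ∀ F : Face, F ∈ meshFaces rightAngles D.carrier δ →
        |∫ γ, ((if γ.kindsIn F = [ArcKind.straight] then (1 : ℝ) else 0) -
              pStraight * (if F ∈ γ.facesVisited then (1 : ℝ) else 0))
            ∂(unifLaw D.carrier δ (a' δ) (b' δ))| ≤
          C * (δ / Metric.infDist ((δ : ℂ) * planeCorner rightAngles F) (frontier D.carrier)) ^ y *
            ∫ γ, (if F ∈ γ.facesVisited then (1 : ℝ) else 0) ∂(unifLaw D.carrier δ (a' δ) (b' δ))

/-! ### Idea 2 — `loop-erased-backbone` -/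

section Osculation

variable {D : Set Face} {a z : MidEdge}

/-- The `i`-th mid-edge of the walk (junk `origin` out of range). -/
def midAt (γ : YBWalk D a z) (i : ℕ) : MidEdge := γ.mids.getD i origin

/-- `γ` has an osculation whose excursion reaches (lattice) distance `≥ r` from the osculation face:
arcs number `i < j` lie in the same face and some mid-edge crossed in between is at distance `≥ r`. -/
def HasFarOsculation (γ : YBWalk D a z) (r : ℝ) : Prop :=
  ∃ i j k : ℕ, i < k ∧ k ≤ j ∧ j < γ.arcs.length ∧
    MidEdge.commonFace (midAt γ i) (midAt γ (i + 1)) = MidEdge.commonFace (midAt γ j) (midAt γ (j + 1)) ∧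
    (MidEdge.commonFace (midAt γ i) (midAt γ (i + 1))).isSome ∧
    r ≤ ‖planeMidpoint rightAngles (midAt γ k) - planeMidpoint rightAngles (midAt γ i)‖

end Osculation

/-- **FIRST LEMMA of idea 2 (LE-1): no mesoscopic osculations of GM's critical square-tiling walk.**
With probability `1 − o(1)` every face visited twice by the critical Yang–Baxter walk is revisited after an
excursion of Euclidean extent `< ε` (macroscopic units), for every `ε > 0`; equivalently the chronological
face-loop-erasure of the walk (a self-avoiding walk on the faces = a uniform-class `ℤ²` SAW path) is
`ε`-close to it in `CurveClass ℂ`. -/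
def NoMesoscopicOsculation : Prop :=
  ∀ (D : DobrushinDomain) (a' b' : ℝ → MidEdge), IsYBEndpointApprox rightAngles D a' b' →
    ∀ ε : ℝ, 0 < ε →
      Tendsto (fun δ : ℝ =>
          (ybLaw rightAngles D.carrier δ 1 (a' δ) (b' δ)).real {γ | HasFarOsculation γ (ε / δ)})
        (𝓝[>] (0 : ℝ)) (𝓝 0)

/-- **KERNEL of idea 2: the attached-excursion tail exponent exceeds `1/ν = 4/3`.** The expected number of
osculations of the critical Yang–Baxter walk whose excursion reaches lattice distance `r` is at most
`C (1/r)^y · δ^{-4/3}`-free form: at most `C · r^{-y}` times the expected number of arcs, for some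
`y > 4/3` (CFT value `y = x₄ − x₂ = 35/12 − 2/3 = 9/4`; Δ₁ = 11/16 for trails is its numerical signature). -/
def AttachedExcursionTail : Prop :=
  ∃ y C : ℝ, 4 / 3 < y ∧ 0 < C ∧
    ∀ (D : DobrushinDomain) (a' b' : ℝ → MidEdge), IsYBEndpointApprox rightAngles D a' b' →
      ∀ r : ℝ, 1 ≤ r → ∀ᶠ δ in 𝓝[>] (0 : ℝ),
        (∫ γ, (({p : ℕ × ℕ | p.1 < p.2 ∧ p.2 < γ.arcs.length ∧
              MidEdge.commonFace (midAt γ p.1) (midAt γ (p.1 + 1)) =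
                MidEdge.commonFace (midAt γ p.2) (midAt γ (p.2 + 1)) ∧
              (MidEdge.commonFace (midAt γ p.1) (midAt γ (p.1 + 1))).isSome ∧
              ∃ k, p.1 < k ∧ k ≤ p.2 ∧
                r ≤ ‖planeMidpoint rightAngles (midAt γ k) - planeMidpoint rightAngles (midAt γ p.1)‖}
              ∩ (Set.Iio γ.arcs.length ×ˢ Set.Iio γ.arcs.length)).ncard : ℝ)
            ∂(ybLaw rightAngles D.carrier δ 1 (a' δ) (b' δ))) ≤
          C * r ^ (-y) * ∫ γ, (numArcs γ : ℝ) ∂(ybLaw rightAngles D.carrier δ 1 (a' δ) (b' δ))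

end Summit.CriticalPhenomena.SAWScalingLimit.Cruxes.YBtoUniform.IdeatorSketchK2

end
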